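import Summits.QuantumAdvantage.QuantumAdvantage.Theorems.WbwObfuscatedGluedTreesKowBbVocabulary
import Summits.QuantumAdvantage.QuantumAdvantage.Theorems.WhiteBoxWalkWbwSuccinctWalkColourStep

/-!
# Stub `stub_simN` — simulating the `N`-bit traversal game inside Game 1
# (crux `WbwObfuscatedGluedTrees`, stmt-QuantumAdvantage-2340; line `knowledge-of-walk-split`, stage 5, lead c4)

Registered stub of the stage-5 skeleton (target `…KnowledgeOfWalkSplit.BlackBox.BlackBoxSoundness`).
For an injection `g : {0,1}^{2n} ↪ {0,1}^N` of the Game-1 names into the `N`-bit strings, every transcript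
algorithm `M` of the `N`-bit game (handed `x ++ name(ENTRANCE)`) is simulated by an algorithm `Mg` of Game 1
(handed `x`; entrance name `0^{2n}`, so the `N`-bit entrance name is the constant `g 0^{2n}`): on the outcome
`(σ, ν)` the simulator runs `M` as if against `(σ, g ∘ ν)`, translating each query `g a` of `M` to the Game-1
query `a` (a dummy query of the wrong length `2n + 1` — answered INVALID — when the query is not in the range of
`g`), and translating each Game-1 answer (the concatenated canonical listing of a SET of `2n`-bit names, uniquely
decodable for `1 ≤ n`) to the `N`-bit answer (the canonical listing of the `g`-image of that set).  The oracle
correspondence `nbrNames σ (g ∘ ν) (g a) = g '' nbrNames σ ν a`, `nbrNames σ (g ∘ ν) a' = ∅` off the range of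
`g`, makes the simulated transcript of `M` its true transcript against `(σ, g ∘ ν)`; so if `M` queries
`g (ν EXIT)` then `Mg` queries `ν EXIT`.
-/

set_option linter.dupNamespace false

noncomputable section

namespace Summit.QuantumAdvantage.QuantumAdvantage.Theorems.WbwObfuscatedGluedTrees.KnowledgeOfWalk.BlackBox

open Literature.Computability.Complexity Literature.Computability.QuantumComplexity
open Literature.Computability.QuantumComplexity.GluedTrees
open Literature.Computability.Cryptography Literature.Computability.Cryptography.ObfuscatedGluedTrees
open Summit.QuantumAdvantage.QuantumAdvantage.Theorems.WbwSuccinctWalk (gluedTreesOracle_of_not_name)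

variable {β : Type} {n N : ℕ}

/-! ## A generic transcript simulator: translate the input, the queries and the answers -/

/-- **The simulator** of `M` through an input translation `fI`, a query translation `fQ` and an answer
translation `fA`: on input `x` after the answers `as` it does what `M` does on input `fI x` after the answers
`as.map fA`, asking `fQ q` when `M` asks `q`. [folklore] -/
def simNAlg (M : OracleAlg β) (fI fQ fA : List Bool → List Bool) : OracleAlg β where
  step x as :=
    match M.step (fI x) (as.map fA) with
    | Sum.inl q => Sum.inl (fQ q)
    | Sum.inr b => Sum.inr b

/-- The step of the simulator (definitional). [folklore] -/
theorem simNAlg_step (M : OracleAlg β) (fI fQ fA : List Bool → List Bool) (x : List Bool) (as : List (List Bool)) :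
    (simNAlg M fI fQ fA).step x as =
      match M.step (fI x) (as.map fA) with
      | Sum.inl q => Sum.inl (fQ q)
      | Sum.inr b => Sum.inr b :=
  rfl

/-- **Simulation lemma**: if translating the answer of `O` to the translated query gives the answer of `O'`
to the query, the transcript of the simulator against `O` is the `fQ`-image of the transcript of `M` against
`O'` (from any partial transcript, for any fuel). [folklore] -/
theorem simNAlg_queriesAux (M : OracleAlg β) (fI fQ fA : List Bool → List Bool) (O O' : Oracle) (x : List Bool)
    (h : ∀ q, fA (O (fQ q)) = O' q) :
    ∀ (k : ℕ) (as : List (List Bool)),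
      (simNAlg M fI fQ fA).queriesAux O x k as = (M.queriesAux O' (fI x) k (as.map fA)).map fQ
  | 0, _ => rfl
  | k + 1, as => by
    unfold OracleAlg.queriesAux
    rw [simNAlg_step]
    cases M.step (fI x) (as.map fA) with
    | inl q =>
      dsimp only [List.map_cons]
      rw [simNAlg_queriesAux M fI fQ fA O O' x h k, List.map_append, List.map_singleton, h]
    | inr b => rfl

/-- **Simulation lemma, from the start**: the queries of the simulator against `O` on `x` are the
`fQ`-images of the queries of `M` against `O'` on `fI x`. [folklore] -/
theorem simNAlg_queries (M : OracleAlg β) (fI fQ fA : List Bool → List Bool) (O O' : Oracle)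
    (h : ∀ q, fA (O (fQ q)) = O' q) (k : ℕ) (x : List Bool) :
    (simNAlg M fI fQ fA).queries O k x = (M.queries O' k (fI x)).map fQ :=
  simNAlg_queriesAux M fI fQ fA O O' x h k []

/-! ## The translations between the `N`-bit game and Game 1 along an injection `g` -/

/-- The `N`-bit oracle's encoding of a SET of `N`-bit names: the canonical listing (by increasing binary value),
concatenated — literally the listing of `gluedTreesOracle` / `GluedTrees.strOracle`. [cite: ChildsEtAl2003, §2 and §4 Game 1] -/
def simNList (N : ℕ) (T : Finset (Fin N → Bool)) : List Bool :=
  ((((T.image nameVal).sort (· ≤ ·)).map (nameOfVal N)).map List.ofFn).flatten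

/-- The encoding of the empty set is the INVALID answer `[]`. [folklore] -/
@[simp] theorem simNList_empty (N : ℕ) : simNList N (∅ : Finset (Fin N → Bool)) = [] := by
  simp [simNList]

/-- The string oracle of an `N`-bit naming at the bit string of an `N`-bit name `b`: the encoding of the
neighbour-name set at `b`. [cite: ChildsEtAl2003, §2 and §4 Game 1] -/
theorem strOracle_ofFn_eq_simNList (σ : CycleDatum n) (ν : Vertex n ↪ (Fin N → Bool)) (b : Fin N → Bool) :
    strOracle σ ν (List.ofFn b) = simNList N (nbrNames σ ν b) := by
  unfold strOracle
  rw [dif_pos (List.length_ofFn (f := b))]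
  have hb : (fun i : Fin N => (List.ofFn b).get (i.cast (List.length_ofFn (f := b)).symm)) = b := by
    funext i; simp
  rw [hb]
  rfl

/-- **Oracle correspondence on the range of `g`**: the neighbour-name set of the re-named instance `(σ, g ∘ ν)`
at `g a` is the `g`-image of the neighbour-name set of `(σ, ν)` at `a`. [folklore] -/
theorem nbrNames_trans_apply (σ : CycleDatum n) (ν : Vertex n ↪ Name n) (g : Name n ↪ (Fin N → Bool)) (a : Name n) :
    nbrNames σ (ν.trans g) (g a) = (nbrNames σ ν a).map g := by
  unfold nbrNames
  rw [Finset.map_eq_image, Finset.biUnion_image]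
  congr 1
  · ext v; simp
  · funext v
    rw [← Finset.map_eq_image, Finset.map_map]

open Classical in
/-- **The query translation**: the `N`-bit query `g a` (as a bit string) becomes the Game-1 query `a`; any other
query becomes a dummy of the wrong length `2n + 1` (answered INVALID by the Game-1 oracle). [folklore] -/
def simNQuery (g : Name n ↪ (Fin N → Bool)) (q : List Bool) : List Bool :=
  if h : ∃ a : Name n, List.ofFn (g a) = q then List.ofFn h.choose else List.replicate (2 * n + 1) false

/-- The query translation on the range of `g` inverts `g`. [folklore] -/
theorem simNQuery_ofFn (g : Name n ↪ (Fin N → Bool)) (a : Name n) : simNQuery g (List.ofFn (g a)) = List.ofFn a := by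
  unfold simNQuery
  have h : ∃ a' : Name n, List.ofFn (g a') = List.ofFn (g a) := ⟨a, rfl⟩
  rw [dif_pos h, g.injective (List.ofFn_injective h.choose_spec)]

/-- The query translation off the range of `g` is the dummy query. [folklore] -/
theorem simNQuery_of_not (g : Name n ↪ (Fin N → Bool)) {q : List Bool} (h : ¬ ∃ a : Name n, List.ofFn (g a) = q) :
    simNQuery g q = List.replicate (2 * n + 1) false := by
  unfold simNQuery
  rw [dif_neg h]

open Classical in
/-- **The answer translation**: a Game-1 answer, the (uniquely decodable, `1 ≤ n`) concatenated canonical listing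
of a set `S` of `2n`-bit names, becomes the `N`-bit encoding of the set `g '' S`; anything else becomes INVALID.
[folklore] -/
def simNAnswer (g : Name n ↪ (Fin N → Bool)) (r : List Bool) : List Bool :=
  if h : ∃ S : Finset (Name n), encL (canon S) = r then simNList N (h.choose.map g) else []

/-- The answer translation on an encoded set (`1 ≤ n`). [folklore] -/
theorem simNAnswer_encL (hn : 1 ≤ n) (g : Name n ↪ (Fin N → Bool)) (S : Finset (Name n)) :
    simNAnswer g (encL (canon S)) = simNList N (S.map g) := by
  unfold simNAnswer
  have h : ∃ S' : Finset (Name n), encL (canon S') = encL (canon S) := ⟨S, rfl⟩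
  rw [dif_pos h, canon_injective (encL_injective hn h.choose_spec)]

/-- The answer translation of INVALID is INVALID (`1 ≤ n`). [folklore] -/
theorem simNAnswer_nil (hn : 1 ≤ n) (g : Name n ↪ (Fin N → Bool)) : simNAnswer g ([] : List Bool) = [] := by
  have h0 : encL (canon (∅ : Finset (Name n))) = [] := by simp [canon, encL]
  have h := simNAnswer_encL hn g ∅
  rwa [h0, Finset.map_empty, simNList_empty] at h

/-- **The oracle correspondence**: translating the Game-1 answer (instance `(σ, ν)`) to the translated query
gives the `N`-bit answer (instance `(σ, g ∘ ν)`) to the query (`1 ≤ n`). [folklore] -/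
theorem simNAnswer_strOracle_simNQuery (hn : 1 ≤ n) (g : Name n ↪ (Fin N → Bool)) (σ : CycleDatum n)
    (ν : Vertex n ↪ Name n) (q : List Bool) :
    simNAnswer g (strOracle σ ν (simNQuery g q)) = strOracle σ (ν.trans g) q := by
  by_cases h : ∃ a : Name n, List.ofFn (g a) = q
  · obtain ⟨a, rfl⟩ := h
    rw [simNQuery_ofFn, strOracle_eq_encL σ ν (List.length_ofFn (f := a)), nameOfStr_ofFn,
      simNAnswer_encL hn, strOracle_ofFn_eq_simNList, nbrNames_trans_apply]
  · rw [simNQuery_of_not g h, strOracle_of_length_ne σ ν (by simp), simNAnswer_nil hn]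
    symm
    unfold strOracle
    split_ifs with hq
    · have hb : ∀ a, g a ≠ fun i => q.get (i.cast hq.symm) := by
        rintro a ha
        refine h ⟨a, ?_⟩
        rw [ha]
        apply List.ext_getElem (by simp [hq]) fun i h₁ h₂ => ?_
        simp [List.get_eq_getElem]
      rw [gluedTreesOracle_of_not_name σ (ν.trans g) fun v => hb (ν v)]
      rfl
    · rfl

/-! ## The stub -/

/-- **Stub `stub_simN`** (simulation of the `N`-bit game inside Game 1): for an injection `g` of the `2n`-bit
names into the `N`-bit strings (`1 ≤ n`), every transcript algorithm `M` of the `N`-bit game (handed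
`x ++ name(ENTRANCE)`) is simulated by an algorithm `Mg` of Game 1 (handed `x`; entrance name `0^{2n}`): on the
outcome `(σ, ν)` it asks `g⁻¹` of `M`'s queries on `(σ, g ∘ ν)` (a dummy of the wrong length for queries outside
the range of `g`) and translates the answers back; so if `M` queries `g (ν EXIT)` then `Mg` queries `ν EXIT`.
[folklore] -/
theorem stub_simN : ∀ (n N : ℕ), 1 ≤ n → ∀ (g : Name n ↪ (Fin N → Bool)) {β : Type} (M : OracleAlg β) (x : List Bool),
    ∃ Mg : OracleAlg β, ∀ (t : ℕ) (σ : CycleDatum n) (ν : Naming n),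
      FindsExitN M x t (σ, ν.1.trans g) → FindsExit Mg x t (σ, ν) := by
  intro n N hn g β M x
  refine ⟨simNAlg M (fun x₀ => x₀ ++ List.ofFn (g fun _ => false)) (simNQuery g) (simNAnswer g),
    fun t σ ν hW => ?_⟩
  change List.ofFn (g (ν.1 (GluedTrees.exit n))) ∈
    M.queries (strOracle σ (ν.1.trans g)) t (x ++ List.ofFn (g (ν.1 (entrance n)))) at hW
  rw [ν.2] at hW
  change List.ofFn (ν.1 (GluedTrees.exit n)) ∈
    (simNAlg M (fun x₀ => x₀ ++ List.ofFn (g fun _ => false)) (simNQuery g) (simNAnswer g)).queries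
      (strOracle σ ν.1) t x
  rw [simNAlg_queries M _ (simNQuery g) (simNAnswer g) (strOracle σ ν.1) (strOracle σ (ν.1.trans g))
    (simNAnswer_strOracle_simNQuery hn g σ ν.1) t x]
  exact List.mem_map.2 ⟨_, hW, simNQuery_ofFn g _⟩

end Summit.QuantumAdvantage.QuantumAdvantage.Theorems.WbwObfuscatedGluedTrees.KnowledgeOfWalk.BlackBox

end
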